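import Summits.QuantumFields.YangMills.Theorems.ColdStartUniversalityLindebergSwapHaarRegime
import Summits.QuantumFields.YangMills.Theorems.ColdStartUniversalityLindebergSwapColdNeighbourhoodII
import Summits.QuantumFields.YangMills.Theorems.ColdStartUniversalityLatticeLangevinMarkovShift
import Summits.QuantumFields.YangMills.Theorems.ColdStartUniversalityLatticeLangevinLawDensityBound
import HarnessLib

/-!
# Crux `ColdStartContinuumCauchy` (stmt-QuantumFields-24810, route `ColdStartUniversality`), LINE 3 «lindeberg_swap»:
# THE REGISTERED RUNG `stub_shortWindowSwap` — PROVED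

`theorem stub_shortWindowSwap : __Registered.stub_shortWindowSwap` (the registered rung of LINE 3, statement VERBATIM: the weak,
fixed-`K`, `t₀`-UNIFORM short-window swap).  For `F`, `γ > 0`, `T > 0`, `K`, `δ > 0` there is `τ₀ > 0` such that for every fine
cold-start solution `U'`, every jointly measurable coarse solution family `V`, every `g ∈ 𝒢_K(A)` and all `t₀ ≥ 0`, `0 ≤ τ ≤ τ₀`:
`|E g(stepDown U'((t₀+τ)/ε')) − E (P_{τ/ε} g)(stepDown U'(t₀/ε'))| ≤ A δ`.

Proof (plan v4 on the crux, all bricks landed by this seat):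
1. MARKOV SHIFT (`integral_window_eq_integral_commutator`, fine reference family `V'` of `TransportPerturbation.solutionFamily_proof`):
   the difference is `E comm(U'_s)`, `comm(y) = (P'_{h'} (g∘stepDown))(y) − (P_h g)(stepDown y)`, `s = t₀/ε'`, `h' = τ/ε'`, `h = τ/ε`.
2. LIPSCHITZ: `|comm(y)| ≤ A Ψ(y)`, `Ψ(y) = E wdisc_K(stepDown V' y_{h'}, stepDown y) + E wdisc_K(V (stepDown y)_h, stepDown y) ∈ [0, 8]`.
3. `E Ψ(U'_s) ≤ δ` in two regimes: `s ≥ t₁` — the law of `U'_s` is `≤ C_d · Haar^{⊗E'}` (`map_le_smul_haar_of_le`) and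
   `∫ Ψ dHaar^{⊗E'} ≤ δ/(C_d+1)` for `h, h' ≤ h₀` (THE HAAR REGIME `integral_smear_pi_haar_le`: dominated convergence at a.e.-regular
   configurations); `s < t₁` — `U'_s` is in the cold ball with probability `1 − O((t₁²+t₁)/r)` (stochastic continuity from `1`) and on
   the cold ball both smears are `≤ δ/16 + C (h² + h)` (`integral_wdisc_stepDown_le_near_one`, `integral_wdisc_le_near_one`,
   `exists_stepDown_ball`); `t₁`, then `C_d`, then `h₀`, then `τ₀` are chosen in this order from `(F, γ, K, δ)` alone.
For `A < 0` the class `𝒢_K(A)` is empty (`exists_wd_pos`).  THEOREMS ONLY, no sorry.  HONEST FRAMING: this closes the registered RUNG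
(weak, fixed cut-off) of LINE 3 only; the XL stubs `stub_oneWindowSwap` / `stub_scalePropagation`, the crux K_A2, the route target and the
Yang–Mills mass gap are NOT proved here.
-/

set_option autoImplicit false

noncomputable section

namespace Summit.QuantumFields.YangMills.Cruxes.ColdStartContinuumCauchy.LindebergSwap

open scoped BigOperators Topology NNReal ENNReal
open MeasureTheory Filter Set Function
open Literature.MathematicalPhysics.QuantumFieldTheory
open Literature.MathematicalPhysics.QuantumFieldTheory.Balaban1983to89
open Literature.MathematicalPhysics.QuantumLattice

/-! ## §1 Three small analytic lemmas -/

/-- **Lipschitz bound of a smear against the base point**: `|E g(Z) − g(x)| ≤ A · E w(Z)` when `|g u − g x| ≤ A w(u)`, `|g| ≤ 1`,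
`0 ≤ w ≤ M`. [folklore] -/
theorem abs_integral_sub_le_lipschitz {Ω X : Type*} [MeasurableSpace Ω] [MeasurableSpace X] {P : Measure Ω}
    [IsProbabilityMeasure P] {Z : Ω → X} (hZ : Measurable Z) {g : X → ℝ} (hgm : Measurable g) (hgb : ∀ u, |g u| ≤ 1)
    {w : X → ℝ} (hw : Measurable w) (hw0 : ∀ z, 0 ≤ w z) {M : ℝ} (hwM : ∀ z, w z ≤ M) {A : ℝ} (x : X)
    (hlip : ∀ u, |g u - g x| ≤ A * w u) :
    |(∫ ω, g (Z ω) ∂P) - g x| ≤ A * ∫ ω, w (Z ω) ∂P := by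
  have hint : Integrable (fun ω => g (Z ω)) P :=
    (integrable_const (1 : ℝ)).mono' (hgm.comp hZ).aestronglyMeasurable (ae_of_all _ fun ω => by
      rw [Real.norm_eq_abs]; exact hgb _)
  have hwZ : Measurable fun ω => w (Z ω) := hw.comp hZ
  have hwint : Integrable (fun ω => A * w (Z ω)) P :=
    ((integrable_const M).mono' hwZ.aestronglyMeasurable (ae_of_all _ fun ω => by
      rw [Real.norm_eq_abs, abs_of_nonneg (hw0 _)]; exact hwM _)).const_mul A
  rw [show (∫ ω, g (Z ω) ∂P) - g x = ∫ ω, (g (Z ω) - g x) ∂P by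
    rw [integral_sub hint (integrable_const _), integral_const, smul_eq_mul, probReal_univ, one_mul]]
  refine (abs_integral_le_integral_abs).trans ?_
  rw [← integral_const_mul]
  exact integral_mono_of_nonneg (ae_of_all _ fun ω => abs_nonneg _) hwint (ae_of_all _ fun ω => hlip _)

/-- **Integration against a dominated measure**: `μ ≤ C · ν` and `0 ≤ f ≤ M` measurable give `∫ f dμ ≤ C ∫ f dν`. [folklore] -/
theorem integral_le_mul_of_le_smul {X : Type*} [MeasurableSpace X] {μ ν : Measure X} [IsFiniteMeasure ν] {C : ℝ} (hC : 0 ≤ C)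
    (hle : μ ≤ (ENNReal.ofReal C) • ν) {f : X → ℝ} (hf : Measurable f) (hf0 : ∀ x, 0 ≤ f x) {M : ℝ} (hfM : ∀ x, f x ≤ M) :
    ∫ x, f x ∂μ ≤ C * ∫ x, f x ∂ν := by
  have hIν : Integrable f ν := (integrable_const M).mono' hf.aestronglyMeasurable
    (ae_of_all _ fun x => by rw [Real.norm_eq_abs, abs_of_nonneg (hf0 _)]; exact hfM _)
  have hI : Integrable f ((ENNReal.ofReal C) • ν) := hIν.smul_measure ENNReal.ofReal_ne_top
  calc ∫ x, f x ∂μ ≤ ∫ x, f x ∂((ENNReal.ofReal C) • ν) :=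
        integral_mono_measure hle (Eventually.of_forall fun x => hf0 x) hI
    _ = C * ∫ x, f x ∂ν := by
        rw [integral_smul_measure, ENNReal.toReal_ofReal hC, smul_eq_mul]

/-- Rate arithmetic: `t ≤ 1` and `t ≤ δ / (16 (C+1))` give `C (t² + t) ≤ δ / 8`. [folklore] -/
theorem rate_le_eighth {C δ t : ℝ} (hC : 0 ≤ C) (hδ : 0 < δ) (h0 : 0 ≤ t) (h1 : t ≤ 1) (h2 : t ≤ δ / (16 * (C + 1))) :
    C * (t ^ 2 + t) ≤ δ / 8 := by
  have hsq : t ^ 2 + t ≤ 2 * t := by nlinarith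
  have hC1 : 0 < C + 1 := by linarith
  have step1 : C * (t ^ 2 + t) ≤ C * (2 * (δ / (16 * (C + 1)))) := by
    gcongr
    exact hsq.trans (by linarith)
  have step2 : C * (2 * (δ / (16 * (C + 1)))) = (C / (C + 1)) * (δ / 8) := by
    field_simp
    ring
  have step3 : (C / (C + 1)) * (δ / 8) ≤ 1 * (δ / 8) := by
    gcongr
    rw [div_le_one hC1]
    linarith
  linarith [step1, step2.le, step3]

/-! ## §2 The registered rung -/

/-- ★ **REGISTERED RUNG `stub_shortWindowSwap` OF LINE 3 «lindeberg_swap» (statement verbatim)**: the weak, fixed-cut-off,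
`t₀`-uniform short-window swap `|E g(stepDown U'((t₀+τ)/ε')) − E (P_{τ/ε} g)(stepDown U'(t₀/ε'))| ≤ A δ` for `0 ≤ τ ≤ τ₀(F, γ, K, δ)`,
uniformly in `t₀ ≥ 0`, the fine cold-start solution, the coarse solution family and `g ∈ 𝒢_K(A)`.  Markov shift + Lipschitz +
(Haar regime by dominated convergence at a.e.-regular configurations | near-cold regime by the cold moduli) — see the file header.
[cite: Balaban1987RG1, (0.4) p.253] [cite: RevuzYor1999, Ch. IX Thm (1.7)] [cite: ShenZhuZhu2022, §3 Lemma 3.3 (p. 13)] -/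
theorem stub_shortWindowSwap : __Registered.stub_shortWindowSwap := by
  intro F γ hγ T hT K δ hδ
  classical
  haveI := Summit.QuantumFields.YangMills.Theorems.ColdStartUniversality.secondCountableTopology_su2
  haveI := Summit.QuantumFields.YangMills.Theorems.ColdStartUniversality.borelSpace_config ((F.P K).sitesPerDir 0)
  haveI := Summit.QuantumFields.YangMills.Theorems.ColdStartUniversality.borelSpace_config ((F.P (K + 1)).sitesPerDir 0)
  have hε' : 0 < (F.P (K + 1)).eps := (F.P (K + 1)).eps_pos
  have hε : 0 < (F.P K).eps := (F.P K).eps_pos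
  -- (1) near-cold data: the two near-cold estimates at `η = δ/16`, the `stepDown` ball, stochastic continuity of the fine dynamics
  have hη : 0 < δ / 16 := by positivity
  obtain ⟨rf, hrf, C₁, hC₁, hfine⟩ := integral_wdisc_stepDown_le_near_one F γ K hη
  obtain ⟨rc, hrc, C₂, hC₂, hcoarse⟩ := integral_wdisc_le_near_one F γ K hη
  obtain ⟨r', hr', hball⟩ := exists_stepDown_ball F K hrc
  obtain ⟨rs, hrsdef⟩ : ∃ rs : ℝ, rs = min rf r' := ⟨_, rfl⟩
  have hrs : 0 < rs := hrsdef ▸ lt_min hrf hr'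
  have hrs1 : rs ≤ rf := hrsdef ▸ min_le_left _ _
  have hrs2 : rs ≤ r' := hrsdef ▸ min_le_right _ _
  obtain ⟨Cf, hCf0, hCf⟩ := Summit.QuantumFields.YangMills.Theorems.ColdStartUniversality.measureReal_hsDist_start_ge_le
    ((F.P (K + 1)).sitesPerDir 0) ((γ * (F.P (K + 1)).eps)⁻¹ / 2)
  -- (2) the regime threshold `t₁` and the density constant `C_d` of the Haar regime
  obtain ⟨t₁r, ht₁rdef⟩ : ∃ t₁r : ℝ, t₁r = min 1 (rs * (δ / 2) / (64 * (Cf + 1))) := ⟨_, rfl⟩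
  have ht₁r : 0 < t₁r := by rw [ht₁rdef]; positivity
  have ht₁r1 : t₁r ≤ 1 := ht₁rdef ▸ min_le_left _ _
  have ht₁r2 : t₁r ≤ rs * (δ / 2) / (64 * (Cf + 1)) := ht₁rdef ▸ min_le_right _ _
  obtain ⟨t₁, ht₁def⟩ : ∃ t₁ : ℝ≥0, t₁ = t₁r.toNNReal := ⟨_, rfl⟩
  have ht₁val : (t₁ : ℝ) = t₁r := by rw [ht₁def]; exact Real.coe_toNNReal _ ht₁r.le
  have ht₁ : 0 < (t₁ : ℝ) := by rw [ht₁val]; exact ht₁r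
  obtain ⟨Cd, hCd0, hdens⟩ := Summit.QuantumFields.YangMills.Theorems.ColdStartUniversality.map_le_smul_haar_of_le
    (L := (F.P (K + 1)).sitesPerDir 0) ((γ * (F.P (K + 1)).eps)⁻¹ / 2) (t₁ := t₁) ht₁ (fun _ => (1 : G2))
  -- (3) the Haar-regime threshold `h₀` at `η₂ = δ/(C_d+1)`
  have hη₂ : 0 < δ / (Cd + 1) := by positivity
  obtain ⟨h₀, hh₀, hHaar⟩ := integral_smear_pi_haar_le F γ hγ K hη₂
  have hh₀' : 0 < (h₀ : ℝ) := NNReal.coe_pos.2 hh₀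
  -- (4) the window length
  obtain ⟨τ₀, hτ₀def⟩ : ∃ τ₀ : ℝ, τ₀ = min (min ((F.P (K + 1)).eps * h₀) ((F.P K).eps * h₀))
      (min ((F.P (K + 1)).eps * min 1 (δ / (16 * (C₁ + 1)))) ((F.P K).eps * min 1 (δ / (16 * (C₂ + 1))))) := ⟨_, rfl⟩
  have hτ₀pos : 0 < τ₀ := by rw [hτ₀def]; positivity
  have hτ₀1 : τ₀ ≤ (F.P (K + 1)).eps * h₀ := hτ₀def ▸ (min_le_left _ _).trans (min_le_left _ _)
  have hτ₀2 : τ₀ ≤ (F.P K).eps * h₀ := hτ₀def ▸ (min_le_left _ _).trans (min_le_right _ _)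
  have hτ₀3 : τ₀ ≤ (F.P (K + 1)).eps * min 1 (δ / (16 * (C₁ + 1))) := hτ₀def ▸ (min_le_right _ _).trans (min_le_left _ _)
  have hτ₀4 : τ₀ ≤ (F.P K).eps * min 1 (δ / (16 * (C₂ + 1))) := hτ₀def ▸ (min_le_right _ _).trans (min_le_right _ _)
  refine ⟨τ₀, hτ₀pos, ?_⟩
  intro Ω mΩ P hP W' hW' U' hU' Ω₂ mΩ₂ P₂ hP₂ W₂ hW₂ V hV A g hg t₀ τ ht₀ hτ0 hττ₀ _hT
  obtain ⟨hU'0, hU'sol⟩ := hU'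
  obtain ⟨hgm, hgb, hglip⟩ := hg
  -- the empty class for `A < 0`
  rcases lt_or_ge A 0 with hAneg | hA
  · exfalso
    obtain ⟨u, v, huv⟩ := Summit.QuantumFields.YangMills.Theorems.TransportPerturbation.exists_wd_pos F K
    have h1 : |g u - g v| ≤ A * wdisc F K u v := hglip u v
    have h2 : A * wdisc F K u v < 0 := mul_neg_of_neg_of_pos hAneg huv
    linarith [abs_nonneg (g u - g v)]
  -- the fine reference family (Markov shift) and the three lattice times
  obtain ⟨Ω₃, mΩ₃, P₃, hP₃, W₃, hW₃, V', hV', hV'm⟩ :=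
    Summit.QuantumFields.YangMills.Theorems.TransportPerturbation.solutionFamily_proof F γ hγ (K + 1)
  have hV'' : IsSolFamily F γ (K + 1) P₃ W₃ hW₃ V' := ⟨hV', hV'm⟩
  obtain ⟨s, hsdef⟩ : ∃ s : ℝ≥0, s = (t₀ / (F.P (K + 1)).eps).toNNReal := ⟨_, rfl⟩
  obtain ⟨tf, htfdef⟩ : ∃ tf : ℝ≥0, tf = (τ / (F.P (K + 1)).eps).toNNReal := ⟨_, rfl⟩
  obtain ⟨tc, htcdef⟩ : ∃ tc : ℝ≥0, tc = (τ / (F.P K).eps).toNNReal := ⟨_, rfl⟩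
  have htf_val : (tf : ℝ) = τ / (F.P (K + 1)).eps := by rw [htfdef]; exact Real.coe_toNNReal _ (div_nonneg hτ0 hε'.le)
  have htc_val : (tc : ℝ) = τ / (F.P K).eps := by rw [htcdef]; exact Real.coe_toNNReal _ (div_nonneg hτ0 hε.le)
  have hs_val : (s : ℝ) = t₀ / (F.P (K + 1)).eps := by rw [hsdef]; exact Real.coe_toNNReal _ (div_nonneg ht₀ hε'.le)
  -- window arithmetic: `tf, tc ≤ h₀`, `tf, tc ≤ 1`, `tf ≤ δ/(16(C₁+1))`, `tc ≤ δ/(16(C₂+1))`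
  have htf_h₀ : tf ≤ h₀ := by
    rw [← NNReal.coe_le_coe, htf_val, div_le_iff₀ hε']; linarith
  have htc_h₀ : tc ≤ h₀ := by
    rw [← NNReal.coe_le_coe, htc_val, div_le_iff₀ hε]; linarith
  have htf_le : (tf : ℝ) ≤ min 1 (δ / (16 * (C₁ + 1))) := by
    rw [htf_val, div_le_iff₀ hε']; linarith
  have htc_le : (tc : ℝ) ≤ min 1 (δ / (16 * (C₂ + 1))) := by
    rw [htc_val, div_le_iff₀ hε]; linarith
  have hrate₁ : C₁ * (((tf : ℝ) ^ 2) + tf) ≤ δ / 8 :=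
    rate_le_eighth hC₁ hδ (NNReal.coe_nonneg tf) (htf_le.trans (min_le_left _ _)) (htf_le.trans (min_le_right _ _))
  have hrate₂ : C₂ * (((tc : ℝ) ^ 2) + tc) ≤ δ / 8 :=
    rate_le_eighth hC₂ hδ (NNReal.coe_nonneg tc) (htc_le.trans (min_le_left _ _)) (htc_le.trans (min_le_right _ _))
  -- measurability of the processes and of the families at fixed times
  have hmUs : Measurable (U' s) := (hU'sol.adapted s).mono (hW'.natFiltration.le s) le_rfl
  have hmV' : ∀ y, Measurable (V' y tf) := fun y => (hV'm tf).comp measurable_prodMk_left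
  have hmV : ∀ x, Measurable (V x tc) := fun x => (hV.2 tc).comp measurable_prodMk_left
  -- the two smears and `Ψ`
  obtain ⟨ψ, hψdef⟩ : ∃ ψ : GaugeConfig 3 ((F.P (K + 1)).sitesPerDir 0) G2 → ℝ,
      ψ = fun y => ∫ ω, wdisc F K (stepDown F K (V' y tf ω)) (stepDown F K y) ∂P₃ := ⟨_, rfl⟩
  obtain ⟨m, hmdef⟩ : ∃ m : GaugeConfig 3 ((F.P K).sitesPerDir 0) G2 → ℝ,
      m = fun x => ∫ ω, wdisc F K (V x tc ω) x ∂P₂ := ⟨_, rfl⟩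
  have hwm : Measurable fun p : GaugeConfig 3 ((F.P K).sitesPerDir 0) G2 × GaugeConfig 3 ((F.P K).sitesPerDir 0) G2 =>
      wdisc F K p.1 p.2 := measurable_wdisc' F K
  have hwm'0 := (measurable_wdisc' F K).comp
    (((measurable_stepDown F K).comp measurable_fst).prodMk ((measurable_stepDown F K).comp measurable_snd) :
      Measurable fun p : GaugeConfig 3 ((F.P (K + 1)).sitesPerDir 0) G2 × GaugeConfig 3 ((F.P (K + 1)).sitesPerDir 0) G2 =>
        (stepDown F K p.1, stepDown F K p.2))
  have hwm' : Measurable fun p : GaugeConfig 3 ((F.P (K + 1)).sitesPerDir 0) G2 × GaugeConfig 3 ((F.P (K + 1)).sitesPerDir 0) G2 =>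
      wdisc F K (stepDown F K p.1) (stepDown F K p.2) := hwm'0
  have hψm : Measurable ψ := by
    rw [hψdef]
    exact measurable_integral_family P₃ (hV'm tf) (f := fun a b => wdisc F K (stepDown F K a) (stepDown F K b)) hwm'
  have hmm : Measurable m := by
    rw [hmdef]; exact measurable_integral_family P₂ (hV.2 tc) hwm
  have hint4 : ∀ {Ω : Type} [MeasurableSpace Ω] (P : Measure Ω) [IsProbabilityMeasure P] (f : Ω → ℝ),
      (∀ ω, 0 ≤ f ω) → (∀ ω, f ω ≤ 4) → 0 ≤ ∫ ω, f ω ∂P ∧ ∫ ω, f ω ∂P ≤ 4 := by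
    intro Ω _ P _ f h0 h4
    refine ⟨integral_nonneg h0, ?_⟩
    have h := integral_mono_of_nonneg (μ := P) (Eventually.of_forall h0) (integrable_const (4 : ℝ)) (Eventually.of_forall h4)
    simpa using h
  have hψbd : ∀ y, 0 ≤ ψ y ∧ ψ y ≤ 4 := fun y => by
    rw [hψdef]
    exact hint4 P₃ _ (fun ω => (wdisc_nonneg_le_four F K _ _).1) (fun ω => (wdisc_nonneg_le_four F K _ _).2)
  have hmbd : ∀ x, 0 ≤ m x ∧ m x ≤ 4 := fun x => by
    rw [hmdef]
    exact hint4 P₂ _ (fun ω => (wdisc_nonneg_le_four F K _ _).1) (fun ω => (wdisc_nonneg_le_four F K _ _).2)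
  obtain ⟨Ψ, hΨdef⟩ : ∃ Ψ : GaugeConfig 3 ((F.P (K + 1)).sitesPerDir 0) G2 → ℝ, Ψ = fun y => ψ y + m (stepDown F K y) :=
    ⟨_, rfl⟩
  have hΨm : Measurable Ψ := by rw [hΨdef]; exact hψm.add (hmm.comp (measurable_stepDown F K))
  have hΨ0 : ∀ y, 0 ≤ Ψ y := fun y => by rw [hΨdef]; exact add_nonneg (hψbd y).1 (hmbd _).1
  have hΨ8 : ∀ y, Ψ y ≤ 8 := fun y => by rw [hΨdef]; linarith [(hψbd y).2, (hmbd (stepDown F K y)).2]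
  -- the coarse semigroup value `Qg = P_{tc} g` is measurable and bounded by `1`
  have hQm0 := measurable_integral_family P₂ (hV.2 tc) (f := fun a _ => g a) (hgm.comp measurable_fst)
  have hQm : Measurable (markovTransition V P₂ tc g) := hQm0
  have hQb : ∀ x, |markovTransition V P₂ tc g x| ≤ 1 := by
    intro x
    show |∫ ω, g (V x tc ω) ∂P₂| ≤ 1
    refine (abs_integral_le_integral_abs).trans ?_
    have h := integral_mono_of_nonneg (μ := P₂) (Eventually.of_forall fun ω => abs_nonneg (g (V x tc ω)))
      (integrable_const (1 : ℝ)) (Eventually.of_forall fun ω => hgb (V x tc ω))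
    simpa using h
  have hintQ : Integrable (fun ω => markovTransition V P₂ tc g (stepDown F K (U' s ω))) P :=
    (integrable_const (1 : ℝ)).mono' (hQm.comp ((measurable_stepDown F K).comp hmUs)).aestronglyMeasurable
      (ae_of_all _ fun ω => by rw [Real.norm_eq_abs]; exact hQb _)
  -- STEP 1: the Markov shift
  have htime : ((t₀ + τ) / (F.P (K + 1)).eps).toNNReal =
      (t₀ / (F.P (K + 1)).eps).toNNReal + (τ / (F.P (K + 1)).eps).toNNReal := by
    rw [add_div]; exact Real.toNNReal_add (div_nonneg ht₀ hε'.le) (div_nonneg hτ0 hε'.le)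
  have hcomm := Summit.QuantumFields.YangMills.Theorems.ColdStartUniversality.integral_window_eq_integral_commutator
    ((γ * (F.P (K + 1)).eps)⁻¹ / 2) (fun _ => (1 : G2)) hW' hU'0 hU'sol hW₃ V' hV' hV'm (S := stepDown F K)
    (measurable_stepDown F K) hgm hgb (markovTransition V P₂ tc g) s tf hintQ
  rw [htime, ← hsdef, ← htfdef, ← htcdef, hcomm]
  -- STEP 2: the Lipschitz bound `|comm(y)| ≤ A Ψ(y)`
  have hpt : ∀ y : GaugeConfig 3 ((F.P (K + 1)).sitesPerDir 0) G2,
      |markovTransition V' P₃ tf (fun u => g (stepDown F K u)) y - markovTransition V P₂ tc g (stepDown F K y)| ≤ A * Ψ y := by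
    intro y
    show |(∫ ω, g (stepDown F K (V' y tf ω)) ∂P₃) - ∫ ω, g (V (stepDown F K y) tc ω) ∂P₂| ≤ A * Ψ y
    have hg10 := (measurable_wdisc' F K).comp
      (measurable_id.prodMk (measurable_const (β := GaugeConfig 3 ((F.P K).sitesPerDir 0) G2) (a := stepDown F K y)))
    have hg1 : Measurable fun u : GaugeConfig 3 ((F.P K).sitesPerDir 0) G2 => wdisc F K u (stepDown F K y) := hg10
    have H1 : |(∫ ω, g (stepDown F K (V' y tf ω)) ∂P₃) - g (stepDown F K y)| ≤
        A * ∫ ω, wdisc F K (stepDown F K (V' y tf ω)) (stepDown F K y) ∂P₃ :=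
      abs_integral_sub_le_lipschitz (Z := fun ω => stepDown F K (V' y tf ω)) ((measurable_stepDown F K).comp (hmV' y)) hgm hgb
        hg1 (fun z => (wdisc_nonneg_le_four F K _ _).1) (fun z => (wdisc_nonneg_le_four F K _ _).2) (stepDown F K y)
        (fun u => hglip u (stepDown F K y))
    have H2 : |g (stepDown F K y) - ∫ ω, g (V (stepDown F K y) tc ω) ∂P₂| ≤
        A * ∫ ω, wdisc F K (V (stepDown F K y) tc ω) (stepDown F K y) ∂P₂ := by
      rw [abs_sub_comm]
      exact abs_integral_sub_le_lipschitz (Z := V (stepDown F K y) tc) (hmV _) hgm hgb hg1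
        (fun z => (wdisc_nonneg_le_four F K _ _).1) (fun z => (wdisc_nonneg_le_four F K _ _).2) (stepDown F K y)
        (fun u => hglip u (stepDown F K y))
    have hΨy : Ψ y = (∫ ω, wdisc F K (stepDown F K (V' y tf ω)) (stepDown F K y) ∂P₃) +
        ∫ ω, wdisc F K (V (stepDown F K y) tc ω) (stepDown F K y) ∂P₂ := by
      rw [hΨdef, hψdef, hmdef]
    calc |(∫ ω, g (stepDown F K (V' y tf ω)) ∂P₃) - ∫ ω, g (V (stepDown F K y) tc ω) ∂P₂|
        = |((∫ ω, g (stepDown F K (V' y tf ω)) ∂P₃) - g (stepDown F K y)) +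
            (g (stepDown F K y) - ∫ ω, g (V (stepDown F K y) tc ω) ∂P₂)| := by rw [sub_add_sub_cancel]
      _ ≤ |(∫ ω, g (stepDown F K (V' y tf ω)) ∂P₃) - g (stepDown F K y)| +
            |g (stepDown F K y) - ∫ ω, g (V (stepDown F K y) tc ω) ∂P₂| := abs_add_le _ _
      _ ≤ A * (∫ ω, wdisc F K (stepDown F K (V' y tf ω)) (stepDown F K y) ∂P₃) +
            A * ∫ ω, wdisc F K (V (stepDown F K y) tc ω) (stepDown F K y) ∂P₂ := add_le_add H1 H2
      _ = A * Ψ y := by rw [hΨy]; ring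
  -- hence the difference is at most `A · E Ψ(U'_s)`
  have hcm0 := measurable_integral_family P₃ (hV'm tf) (f := fun a _ => g (stepDown F K a))
    ((hgm.comp (measurable_stepDown F K)).comp measurable_fst)
  have hcm : Measurable (markovTransition V' P₃ tf (fun u => g (stepDown F K u))) := hcm0
  have hΨU : Measurable fun ω => Ψ (U' s ω) := hΨm.comp hmUs
  have hIΨ : Integrable (fun ω => A * Ψ (U' s ω)) P :=
    ((integrable_const (8 : ℝ)).mono' hΨU.aestronglyMeasurable (ae_of_all _ fun ω => by
      rw [Real.norm_eq_abs, abs_of_nonneg (hΨ0 _)]; exact hΨ8 _)).const_mul A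
  have hStep2 : |∫ ω, (markovTransition V' P₃ tf (fun u => g (stepDown F K u)) (U' s ω) -
      markovTransition V P₂ tc g (stepDown F K (U' s ω))) ∂P| ≤ A * ∫ ω, Ψ (U' s ω) ∂P := by
    refine (abs_integral_le_integral_abs).trans ?_
    rw [← integral_const_mul]
    exact integral_mono_of_nonneg (ae_of_all _ fun ω => abs_nonneg _) hIΨ (ae_of_all _ fun ω => hpt _)
  refine hStep2.trans (mul_le_mul_of_nonneg_left ?_ hA)
  -- STEP 3: `E Ψ(U'_s) ≤ δ`, in the two regimes
  rcases le_or_gt t₁ s with hts | hst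
  · -- HAAR REGIME `s ≥ t₁`: bounded density against `Haar^{⊗E'}` and the dominated-convergence threshold
    have hs_eq : t₁ + (s - t₁) = s := add_tsub_cancel_of_le hts
    have hden := hdens hW' hU'0 hU'sol (s - t₁)
    rw [hs_eq] at hden
    have hden' : P.map (U' s) ≤ (ENNReal.ofReal Cd) •
        (Measure.pi fun _ : Edge 3 ((F.P (K + 1)).sitesPerDir 0) => (HaarData.haar : Measure G2)) := hden
    have hH := hHaar Ω₂ mΩ₂ P₂ hP₂ W₂ hW₂ V hV Ω₃ mΩ₃ P₃ hP₃ W₃ hW₃ V' hV'' tc tf htc_h₀ htf_h₀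
    have hH' : ∫ y, Ψ y ∂(Measure.pi fun _ : Edge 3 ((F.P (K + 1)).sitesPerDir 0) => (HaarData.haar : Measure G2)) ≤
        δ / (Cd + 1) := by
      rw [hΨdef, hψdef, hmdef]; exact hH
    calc ∫ ω, Ψ (U' s ω) ∂P = ∫ y, Ψ y ∂(P.map (U' s)) := (integral_map hmUs.aemeasurable hΨm.aestronglyMeasurable).symm
      _ ≤ Cd * ∫ y, Ψ y ∂(Measure.pi fun _ : Edge 3 ((F.P (K + 1)).sitesPerDir 0) => (HaarData.haar : Measure G2)) :=
          integral_le_mul_of_le_smul hCd0 hden' hΨm hΨ0 hΨ8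
      _ ≤ Cd * (δ / (Cd + 1)) := by gcongr
      _ = δ * (Cd / (Cd + 1)) := by ring
      _ ≤ δ * 1 := by
          gcongr
          rw [div_le_one (by linarith)]; linarith
      _ = δ := mul_one δ
  · -- NEAR-COLD REGIME `s < t₁`: the cold ball of radius `rs` and its complement
    have hdm : Measurable fun y : GaugeConfig 3 ((F.P (K + 1)).sitesPerDir 0) G2 => ∑ e, hsForm 2
        ((fundamentalRep (Fin 2) (y e) : Matrix (Fin 2) (Fin 2) ℂ) - fundamentalRep (Fin 2) (1 : G2))
        ((fundamentalRep (Fin 2) (y e) : Matrix (Fin 2) (Fin 2) ℂ) - fundamentalRep (Fin 2) (1 : G2)) :=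
      (Summit.QuantumFields.YangMills.Theorems.ColdStartUniversality.continuous_hsDist
        (L := (F.P (K + 1)).sitesPerDir 0) continuous_id (continuous_const (y := fun _ => (1 : G2)))).measurable
    have hη' : 0 < 3 * (δ / 16) + C₁ * (((tf : ℝ) ^ 2) + tf) + C₂ * (((tc : ℝ) ^ 2) + tc) := by positivity
    have hsmall : ∀ y : GaugeConfig 3 ((F.P (K + 1)).sitesPerDir 0) G2,
        (∑ e, hsForm 2 ((fundamentalRep (Fin 2) (y e) : Matrix (Fin 2) (Fin 2) ℂ) - fundamentalRep (Fin 2) (1 : G2))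
            ((fundamentalRep (Fin 2) (y e) : Matrix (Fin 2) (Fin 2) ℂ) - fundamentalRep (Fin 2) (1 : G2))) < rs →
          Ψ y < 3 * (δ / 16) + C₁ * (((tf : ℝ) ^ 2) + tf) + C₂ * (((tc : ℝ) ^ 2) + tc) := by
      intro y hy
      have h1 : ψ y ≤ δ / 16 + C₁ * (((tf : ℝ) ^ 2) + tf) := by
        rw [hψdef]
        exact hfine y (le_of_lt (lt_of_lt_of_le hy hrs1)) Ω₃ P₃ W₃ hW₃ (V' y) (hV' y).1 (hV' y).2 tf
      have h2 : m (stepDown F K y) ≤ δ / 16 + C₂ * (((tc : ℝ) ^ 2) + tc) := by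
        rw [hmdef]
        exact hcoarse (stepDown F K y) (hball y (le_of_lt (lt_of_lt_of_le hy hrs2))) Ω₂ P₂ W₂ hW₂ (V (stepDown F K y))
          (hV.1 _).1 (hV.1 _).2 tc
      rw [hΨdef]
      show ψ y + m (stepDown F K y) < _
      linarith
    have hE := integral_le_add_mul_measureReal (P := P) hmUs hΨm hdm hΨ0 hΨ8 hη'.le hsmall
    -- the tail from the start `1`
    have hT := hCf (fun _ => 1) Ω P W' hW' U' hU'0 hU'sol s rs hrs
    have hs1 : (s : ℝ) ≤ 1 := by
      have : (s : ℝ) < t₁ := NNReal.coe_lt_coe.2 hst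
      linarith [ht₁val ▸ this, ht₁r1]
    have hs2 : (s : ℝ) ≤ rs * (δ / 2) / (64 * (Cf + 1)) := by
      have : (s : ℝ) < t₁ := NNReal.coe_lt_coe.2 hst
      linarith [ht₁val ▸ this, ht₁r2]
    have htail := four_mul_tail_le hCf0 hrs (half_pos hδ) (NNReal.coe_nonneg s) hs1 hs2
    have h8 : 8 * P.real {ω | rs ≤ ∑ e, hsForm 2
        ((fundamentalRep (Fin 2) (U' s ω e) : Matrix (Fin 2) (Fin 2) ℂ) - fundamentalRep (Fin 2) (1 : G2))
        ((fundamentalRep (Fin 2) (U' s ω e) : Matrix (Fin 2) (Fin 2) ℂ) - fundamentalRep (Fin 2) (1 : G2))} ≤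
        8 * (Cf * (((s : ℝ) ^ 2) + s) / rs) := mul_le_mul_of_nonneg_left hT (by norm_num)
    linarith [hE, h8, htail, hrate₁, hrate₂]

end Summit.QuantumFields.YangMills.Cruxes.ColdStartContinuumCauchy.LindebergSwap

end
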